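import Literature.NumberTheory.CubicFields.ThreeTorsionSumFirstOrder
import Literature.NumberTheory.CubicFields.ShintaniCoeffPositivity
import Literature.NumberTheory.CubicFields.MaximalStabilizer
import Literature.NumberTheory.NumberFields.DiscriminantSquareRoot
import HarnessLib

/-!
# The Shintani coefficient at a fundamental discriminant: `a(D) = #{cubic fields of disc D} + 1/2`

Topic `Literature/NumberTheory/CubicFields`; the per-discriminant form of the bookkeeping (29) /
Prop. 4.3 of Bhargava–Taniguchi–Thorne 2023 (`N^±_{≤3} = N₃^± + ½ N₂^± + …`), needed for the count (3)
of cubic fields of FUNDAMENTAL discriminant (§5: "an application of Propositions 4.2 and 4.3 finishes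
the proof"). The Dirichlet coefficient of Shintani's zeta function `ξ^±(s)` at `|D|`,
`a(D) = Σ_{O : GL₂(ℤ)-orbit, Disc = D} 1/|Stab(O)|` (`ShintaniZeta.shintaniCoeffWith 1 D`, BTT (11)),
is, for a fundamental discriminant `D`:

* the irreducible orbits of discriminant `D` are the cubic fields of discriminant `D`
  (`cubicFieldCountOfDisc_eq_card_irredOrbitsOfDisc`, fundamental ⇒ maximal), each of weight `1`:
  a cubic field of fundamental discriminant is not Galois, because **a Galois number field of odd
  degree has square discriminant** (`isSquare_discr_of_isGalois`: `√d_F = det(σⱼ xᵢ)` is fixed by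
  every automorphism of odd order, `DiscriminantSquareRoot.lean`) while a fundamental discriminant is
  not a square; so `|Stab| = |Aut 𝓞_K| = 1` (`stabCard_eq_one_iff_not_isGalois`);
* plus exactly ONE reducible orbit, that of `ℤ × 𝓞_{ℚ(√D)}` (`ReducibleMaximality`: existence and
  uniqueness of the maximal reducible form of discriminant `D`), of weight `1/2`
  (`card_stabilizer_eq_two_of_isFundamental`).

Hence **`shintaniCoeffReal_of_isFundamental`: `a(D) = cubicFieldCountOfDisc D + 1/2`**, with
`shintaniCoeffReal D : ℝ` the real-valued coefficient (`= shintaniCoeffWith 1 D`,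
`ofReal_shintaniCoeffReal`; `0 ≤ a(D) ≤ h(D)`).

## References

* M. Bhargava, T. Taniguchi, F. Thorne, *Improved error estimates for the Davenport–Heilbronn
  theorems*, Math. Ann. 389 (2024) = arXiv:2107.12819, §2.4 (11), §4.1 (28)–(29), Prop. 4.3, §5
  [BhargavaTaniguchiThorne2023].
* R. B. Ash, *A Course in Algebraic Number Theory*, §2.3 (`d = det(σᵢ xⱼ)²`) [Ash2010].
-/

noncomputable section

namespace Literature.NumberTheory.CubicFields

open BinaryCubic RingOfForm NumberField Literature.NumberTheory.NumberFields

/-! ### The real-valued coefficient `a(D)` -/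

/-- **`a(D)` as a real number**: `Σ_{O : GL₂(ℤ)-orbit of discriminant D} 1/|Stab(O)|`, the coefficient
of `|D|^{-s}` in Shintani's `ξ^{sgn D}(s)` (BTT (11); `= shintaniCoeffWith 1 D`, which is this real
number cast to `ℂ`). A finite sum for `D ≠ 0`. [cite: BhargavaTaniguchiThorne2023, §2.4 (11) (the coefficients a^±(n))] -/
def shintaniCoeffReal (D : ℤ) : ℝ :=
  ∑ᶠ O : orbitsOfDisc D, ((stabCard (orbitRep O) : ℝ))⁻¹

/-- `a(D)` as a finite sum over the finite type of orbits. [folklore] -/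
theorem shintaniCoeffReal_eq_sum {D : ℤ} [Fintype (orbitsOfDisc D)] :
    shintaniCoeffReal D = ∑ O : orbitsOfDisc D, ((stabCard (orbitRep O) : ℝ))⁻¹ := by
  rw [shintaniCoeffReal, finsum_eq_sum_of_fintype]

/-- `a(D)` (complex, `ShintaniZeta.lean`) is the real number `shintaniCoeffReal D`, for `D ≠ 0`. [folklore] -/
theorem ofReal_shintaniCoeffReal {D : ℤ} (hD : D ≠ 0) :
    ((shintaniCoeffReal D : ℝ) : ℂ) = shintaniCoeffWith (fun _ => 1) D := by
  haveI := finite_orbitsOfDisc hD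
  haveI : Fintype (orbitsOfDisc D) := Fintype.ofFinite _
  rw [shintaniCoeffWith_one_eq_sum, shintaniCoeffReal_eq_sum]

/-- `0 ≤ a(D)`. [folklore] -/
theorem shintaniCoeffReal_nonneg (D : ℤ) : 0 ≤ shintaniCoeffReal D :=
  finsum_nonneg fun O => by positivity

/-- `a(D) ≤ h(D)` (each of the `h(D)` orbits has weight `≤ 1`), for `D ≠ 0`. [folklore] -/
theorem shintaniCoeffReal_le_classNumber {D : ℤ} (hD : D ≠ 0) : shintaniCoeffReal D ≤ classNumber D := by
  haveI := finite_orbitsOfDisc hD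
  haveI : Fintype (orbitsOfDisc D) := Fintype.ofFinite _
  rw [shintaniCoeffReal_eq_sum]
  calc ∑ O : orbitsOfDisc D, ((stabCard (orbitRep O) : ℝ))⁻¹ ≤ ∑ _O : orbitsOfDisc D, (1 : ℝ) :=
        Finset.sum_le_sum fun O _ => inv_stabCard_le_one _
    _ = classNumber D := by
        rw [Finset.sum_const, Finset.card_univ, nsmul_eq_mul, mul_one, classNumber, Nat.card_eq_fintype_card]

/-! ### Galois number fields of odd degree have square discriminant -/

/-- **A Galois number field of odd degree has square discriminant.** With `σ₁, …, σₙ` all the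
embeddings `K → K` (they exist as `K/ℚ` is Galois) and an integral basis `xᵢ`, `δ = det(σⱼ xᵢ)`
satisfies `δ² = d_K` and `τ δ = ±δ` for every automorphism `τ`; an automorphism of odd order fixes
`δ` (`DiscriminantSquareRoot.exists_sq_eq_discr_mem_fixedField` with `H = Gal(K/ℚ)` of odd order), so
`δ ∈ K^{Gal} = ℚ` and `d_K = δ²` is the square of a rational, hence of an integer. (For cubic fields:
the Galois = cyclic cubic fields are exactly those of square discriminant; here one direction.)
[cite: Ash2010, §2.3 (2.3.3) and Problem 3 (PDF p. 19)] -/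
theorem isSquare_discr_of_isGalois (K : Type*) [Field K] [NumberField K] [IsGalois ℚ K]
    (hodd : Odd (Module.finrank ℚ K)) : IsSquare (discr K) := by
  classical
  have hcardAut : Nat.card (K ≃ₐ[ℚ] K) = Module.finrank ℚ K := IsGalois.card_aut_eq_finrank ℚ K
  have hcard : Fintype.card (K →ₐ[ℚ] K) = Module.finrank ℚ K := by
    rw [← hcardAut, Nat.card_eq_fintype_card]
    exact (Fintype.card_congr (algEquivEquivAlgHom ℚ K)).symm
  have hH : Odd (Nat.card (⊤ : Subgroup (K ≃ₐ[ℚ] K))) := by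
    rwa [Subgroup.card_top, hcardAut]
  obtain ⟨δ, hmem, -, hsq⟩ := exists_sq_eq_discr_mem_fixedField K K hcard ⊤ hH
  have hfix : ∀ τ : K ≃ₐ[ℚ] K, τ δ = δ := fun τ =>
    (IntermediateField.mem_fixedField_iff ⊤ δ).mp hmem τ (Subgroup.mem_top τ)
  obtain ⟨r, hr⟩ := IntermediateField.mem_bot.mp ((IsGalois.mem_bot_iff_fixed δ).mpr hfix)
  have hr2 : ((r ^ 2 : ℚ) : K) = (((discr K : ℤ) : ℚ) : K) := by
    push_cast
    rw [← hsq, ← hr]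
    rfl
  have hrq : r ^ 2 = (discr K : ℚ) := by exact_mod_cast (algebraMap ℚ K).injective hr2
  exact Rat.isSquare_intCast_iff.mp ⟨r, by rw [← hrq, sq]⟩

/-! ### The orbits of a fundamental discriminant and their weights -/

variable {D : ℤ}

/-- A fundamental discriminant is nonzero. [folklore] -/
theorem ne_zero_of_isFundamental
    (hD : (D % 4 = 1 ∧ Squarefree D ∧ D ≠ 1) ∨ (4 ∣ D ∧ (D / 4 % 4 = 2 ∨ D / 4 % 4 = 3) ∧ Squarefree (D / 4))) :
    D ≠ 0 := by
  rintro rfl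
  rcases hD with ⟨h, -, -⟩ | ⟨-, h, -⟩ <;> norm_num at h

/-- **An irreducible form of fundamental discriminant has trivial stabilizer** (weight `1`): its ring
is the maximal order of the cubic field `K_f` (fundamental ⇒ maximal), `Disc K_f = Disc f` is not a
square, so `K_f` is not Galois (`isSquare_discr_of_isGalois`) and `|Stab(f)| = |Aut K_f| = 1`.
[cite: BhargavaTaniguchiThorne2023, §4.1 (29) (|Aut F| = 1 for a non-Galois cubic field)] -/
theorem stabCard_eq_one_of_isIrreducible_of_isFundamental {f : BinaryCubic ℤ} (hirr : f.IsIrreducible)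
    (hf : (f.disc % 4 = 1 ∧ Squarefree f.disc ∧ f.disc ≠ 1) ∨
      (4 ∣ f.disc ∧ (f.disc / 4 % 4 = 2 ∨ f.disc / 4 % 4 = 3) ∧ Squarefree (f.disc / 4))) :
    stabCard f = 1 := by
  haveI : Fact f.IsIrreducible := ⟨hirr⟩
  have hmax : IsMaximal f := RingOfForm.isMaximal_of_isFundamental_disc hf
  rw [stabCard_eq_one_iff_not_isGalois hmax]
  intro hGal
  have hsq : IsSquare (discr (RatAlgebra f)) :=
    isSquare_discr_of_isGalois (RatAlgebra f) (by rw [finrank_ratAlgebra_eq_three]; decide)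
  rw [← disc_eq_discr_of_ringEquiv_ringOfIntegers finrank_ratAlgebra_eq_three (ringEquivRingOfIntegers hmax)] at hsq
  exact not_isSquare_of_isFundamental hf hsq

/-- **A reducible form of fundamental discriminant has `|Stab| = 2`** (weight `1/2`): it is maximal,
hence `GL₂(ℤ)`-equivalent to a normal form `(0, 1, c, d)` (`ℤ × 𝓞_{ℚ(√D)}`), whose stabilizer has
order `2`. [cite: BhargavaTaniguchiThorne2023, §4.1 (29) (|Aut(F₂ × ℚ)| = 2)] -/
theorem stabCard_eq_two_of_not_isIrreducible_of_isFundamental {f : BinaryCubic ℤ} (hred : ¬ f.IsIrreducible)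
    (hf : (f.disc % 4 = 1 ∧ Squarefree f.disc ∧ f.disc ≠ 1) ∨
      (4 ∣ f.disc ∧ (f.disc / 4 % 4 = 2 ∨ f.disc / 4 % 4 = 3) ∧ Squarefree (f.disc / 4))) :
    stabCard f = 2 := by
  have hmax : IsMaximal f := RingOfForm.isMaximal_of_isFundamental_disc hf
  have h0 : f.disc ≠ 0 := ne_zero_of_isFundamental hf
  obtain ⟨c, d, -, he⟩ := exists_normalForm_of_isMaximal hmax hred h0
  rw [stabCard_eq_of_gl2zEquiv he, stabCard]
  have hdisc : f.disc = c ^ 2 - 4 * d := by rw [← he.disc_eq, disc_reducibleNormalForm]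
  rw [hdisc] at hf
  exact card_stabilizer_eq_two_of_isFundamental hf

/-- The irreducible orbits of discriminant `D`, as a subtype of all orbits of discriminant `D`, are in
bijection with `irredOrbitsOfDisc D` (irreducibility is an orbit invariant). [folklore] -/
def irredOrbitEquiv (D : ℤ) :
    {O : orbitsOfDisc D // (orbitRep O).IsIrreducible} ≃ irredOrbitsOfDisc D where
  toFun O := ⟨O.1.1, orbitRep O.1, (orbitRep_spec O.1).1, O.2, (orbitRep_spec O.1).2⟩
  invFun O := ⟨⟨O.1, O.2.choose, O.2.choose_spec.1, O.2.choose_spec.2.2⟩, by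
    obtain ⟨f, hO, hirr, hdisc⟩ := O.2
    set O' : orbitsOfDisc D := ⟨O.1, O.2.choose, O.2.choose_spec.1, O.2.choose_spec.2.2⟩
    have h1 : O.1 = gl2zOrbit (orbitRep O') := (orbitRep_spec O').1
    rw [hO] at h1
    exact ((gl2zOrbit_eq_iff.mp h1).isIrreducible_iff).mp hirr⟩
  left_inv O := by ext1; rfl
  right_inv O := by ext1; rfl

/-- **There is exactly one reducible orbit of each fundamental discriminant** (that of
`ℤ × 𝓞_{ℚ(√D)}`): existence `exists_isMaximal_reducible_of_isFundamental`, uniqueness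
`gl2zEquiv_of_isMaximal_of_disc_eq` (forms of fundamental discriminant being maximal). [cite: BhargavaTaniguchiThorne2023, §4 (maximal reducible rings are ℤ × 𝓞_F and ℤ³)] -/
theorem existsUnique_reducible_orbit
    (hD : (D % 4 = 1 ∧ Squarefree D ∧ D ≠ 1) ∨ (4 ∣ D ∧ (D / 4 % 4 = 2 ∨ D / 4 % 4 = 3) ∧ Squarefree (D / 4))) :
    ∃! O : orbitsOfDisc D, ¬ (orbitRep O).IsIrreducible := by
  obtain ⟨f, hmax, hred, hdisc⟩ := exists_isMaximal_reducible_of_isFundamental (Or.inl hD)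
  let O₀ : orbitsOfDisc D := ⟨gl2zOrbit f, f, rfl, hdisc⟩
  have hrep : GL2ZEquiv f (orbitRep O₀) := gl2zOrbit_eq_iff.mp (orbitRep_spec O₀).1
  refine ⟨O₀, fun h => hred (hrep.isIrreducible_iff.mpr h), fun O hO => ?_⟩
  have hdO : (orbitRep O).disc = D := (orbitRep_spec O).2
  have hmaxO : IsMaximal (orbitRep O) := RingOfForm.isMaximal_of_isFundamental_disc (by rw [hdO]; exact hD)
  have heq : GL2ZEquiv (orbitRep O) f :=
    gl2zEquiv_of_isMaximal_of_disc_eq hmaxO hO hmax hred (by rw [hdO]; exact ne_zero_of_isFundamental hD)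
      (by rw [hdO, hdisc])
  apply Subtype.ext
  rw [(orbitRep_spec O).1]
  exact gl2zOrbit_eq_iff.mpr heq

/-- **`a(D) = #{cubic fields of discriminant D} + 1/2` for every fundamental discriminant `D`**
(BTT (29) / Prop. 4.3 at a single fundamental discriminant: the orbits of discriminant `D` are the
cubic fields of discriminant `D`, of weight `1` each, and `ℤ × 𝓞_{ℚ(√D)}`, of weight `1/2`).
[cite: BhargavaTaniguchiThorne2023, §4.1 (28)–(29) with Prop. 4.3 (N_{≤3} = N₃ + ½N₂ + …, per discriminant)] -/
theorem shintaniCoeffReal_of_isFundamental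
    (hD : (D % 4 = 1 ∧ Squarefree D ∧ D ≠ 1) ∨ (4 ∣ D ∧ (D / 4 % 4 = 2 ∨ D / 4 % 4 = 3) ∧ Squarefree (D / 4))) :
    shintaniCoeffReal D = cubicFieldCountOfDisc D + 1 / 2 := by
  classical
  haveI := finite_orbitsOfDisc (ne_zero_of_isFundamental hD)
  haveI : Fintype (orbitsOfDisc D) := Fintype.ofFinite _
  have hdisc : ∀ O : orbitsOfDisc D, (orbitRep O).disc = D := fun O => (orbitRep_spec O).2
  rw [shintaniCoeffReal_eq_sum, ← Finset.sum_filter_add_sum_filter_not Finset.univ (fun O => (orbitRep O).IsIrreducible)]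
  -- irreducible orbits: weight `1` each, `cubicFieldCountOfDisc D` of them
  have h1 : ∑ O ∈ Finset.univ.filter (fun O : orbitsOfDisc D => (orbitRep O).IsIrreducible),
      ((stabCard (orbitRep O) : ℝ))⁻¹ = cubicFieldCountOfDisc D := by
    rw [Finset.sum_congr rfl fun O hO => by
      rw [stabCard_eq_one_of_isIrreducible_of_isFundamental (Finset.mem_filter.mp hO).2 ((hdisc O).symm ▸ hD)]]
    rw [Finset.sum_const, nsmul_eq_mul, Nat.cast_one, inv_one, mul_one, cubicFieldCountOfDisc_eq_card_irredOrbitsOfDisc hD,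
      ← Nat.card_congr (irredOrbitEquiv D), Nat.card_eq_fintype_card, Fintype.card_subtype]
  -- reducible orbits: exactly one, of weight `1/2`
  have h2 : ∑ O ∈ Finset.univ.filter (fun O : orbitsOfDisc D => ¬ (orbitRep O).IsIrreducible),
      ((stabCard (orbitRep O) : ℝ))⁻¹ = 1 / 2 := by
    obtain ⟨O₀, hO₀, huniq⟩ := existsUnique_reducible_orbit hD
    have hset : Finset.univ.filter (fun O : orbitsOfDisc D => ¬ (orbitRep O).IsIrreducible) = {O₀} := by
      ext O
      simp only [Finset.mem_filter, Finset.mem_univ, true_and, Finset.mem_singleton]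
      exact ⟨fun h => huniq O h, fun h => h ▸ hO₀⟩
    rw [hset, Finset.sum_singleton,
      stabCard_eq_two_of_not_isIrreducible_of_isFundamental hO₀ ((hdisc O₀).symm ▸ hD)]
    norm_num
  rw [h1, h2]

end Literature.NumberTheory.CubicFields

end
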